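import Mathlib.Algebra.BigOperators.Group.Finset.Basic
import Mathlib.Algebra.Order.BigOperators.Group.Finset
import Literature.Computability.Cryptography.EditDistFacts
import HarnessLib

/-!
# Edit distance: counting bounds, blocks of one symbol, substrings, splitting with positions

Generic consequences of the Wagner–Fischer recursion for the Levenshtein distance `editDist`
(`SequenceProblems`, `EditDistFacts`), used in the proof of the Bringmann–Künnemann alignment
gadget (FOCS 2015, §5.2, Lemma 5.4) but independent of it:

* counting: `count_le_editDist_add_count` — every occurrence of a symbol `σ` in `v` is matched to
  an occurrence of `σ` in `u` or paid for, `#σ(v) ≤ editDist u v + #σ(u)`; and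
  `length_le_editDist_add_count` — against a block `σ^N` every non-`σ` symbol of `u` is paid for,
  `|u| ≤ editDist u σ^N + #σ(u)`; together with the traversal "substitute the non-`σ` symbols,
  match the rest, delete the surplus of the block" this gives the exact value
  `editDist u σ^N = N - #σ(u)` for `|u| ≤ N` (`editDist_replicate_add_count`; BK15, proof of
  Lemma 5.8: "all zeroes of `x'` can be matched to zeroes of `L`, while all ones of `x'` have to
  be substituted; the remaining zeroes of `L` have to be deleted");
* substrings `x[a..b) = (x.take b).drop a`: removing a prefix costs at most its length
  (`editDist_le_editDist_append_left_add_length`, the prefix form of BK15 Fact 5.5(3)), and moving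
  the two ends of a substring by `|a-c|` and `|b-d|` changes the distance to a fixed string by at
  most that much (`editDist_drop_take_le`);
* splitting with positions (BK15 Fact 5.7): `exists_boundaries_editDist_le` — for blocks
  `B₀, …, B_k` there are cut points `0 = t₀ ≤ t₁ ≤ ⋯ ≤ t_{k+1} = |x|` with
  `∑ editDist x[tᵢ..tᵢ₊₁) Bᵢ ≤ editDist x (B₀ ⋯ B_k)`; this is `exists_splits_editDist_le` with the
  pieces addressed by their offsets, which is the form in which the positions of the pieces can
  be compared with the positions of the blocks of `x`;
* bookkeeping for substrings: `count_take_add_count_drop_take`, `length_drop_take'`,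
  `count_take_mono`, `count_drop_take_le`.

## References

* K. Bringmann, M. Künnemann, *Quadratic conditional lower bounds for string problems and dynamic
  time warping*, FOCS 2015 (arXiv:1502.01063), §5.2, Facts 5.5–5.7 and the proof of Lemma 5.8.
* R. A. Wagner, M. J. Fischer, *The string-to-string correction problem*, J. ACM 21 (1974), §2.
-/

namespace Literature.Computability.Cryptography

open Finset

variable {α : Type*} [DecidableEq α]

/-! ### Counting bounds -/

/-- Every occurrence of `σ` in `v` is matched to an occurrence of `σ` in `u`, or it is inserted or
substituted: `#σ(v) ≤ editDist u v + #σ(u)` (Wagner–Fischer 1974, §2, traces). [cite: WagnerFischer1974, §2] -/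
theorem count_le_editDist_add_count (u v : List α) (σ : α) :
    v.count σ ≤ editDist u v + u.count σ := by
  induction u, v using editDist.induct with
  | case1 l => simpa using List.count_le_length
  | case2 a xs => simp
  | case3 a xs b ys ih1 ih2 ih3 =>
      simp only [editDist_cons_cons, List.count_cons, beq_iff_eq] at ih1 ih2 ⊢
      split_ifs at ih1 ih2 ⊢ <;> first | omega | (subst_vars; simp at *)

/-- Against a list all of whose symbols are `σ`, every non-`σ` symbol of `u` is deleted or
substituted: `|u| ≤ editDist u v + #σ(u)` (BK15, proof of Lemma 5.8: "all ones of `x'` have to be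
substituted"). [cite: BringmannKunnemannFOCS2015, Lemma 5.8 (proof)] -/
theorem length_le_editDist_add_count (u v : List α) (σ : α) (hv : ∀ b ∈ v, b = σ) :
    u.length ≤ editDist u v + u.count σ := by
  induction u, v using editDist.induct with
  | case1 l => simp
  | case2 a xs => simp
  | case3 a xs b ys ih1 ih2 ih3 =>
      have hb : b = σ := hv b (by simp)
      have hys : ∀ c ∈ ys, c = σ := fun c hc => hv c (by simp [hc])
      have h1 := ih1 hv
      have h2 := ih2 hys
      have h3 := ih3 hys
      subst hb
      simp only [editDist_cons_cons, List.count_cons, beq_iff_eq, List.length_cons] at h1 h2 h3 ⊢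
      split_ifs at h1 h2 ⊢ <;> omega

/-- `|u| ≤ editDist u σ^N + #σ(u)`: the block form of `length_le_editDist_add_count`.
[cite: BringmannKunnemannFOCS2015, Lemma 5.8 (proof)] -/
theorem length_le_editDist_replicate_add_count (u : List α) (σ : α) (N : ℕ) :
    u.length ≤ editDist u (List.replicate N σ) + u.count σ :=
  length_le_editDist_add_count u _ σ fun _ hb => List.eq_of_mem_replicate hb

/-- `N ≤ editDist u σ^N + #σ(u)`: at most `#σ(u)` symbols of the block `σ^N` are matched, the others
are paid for (the block form of `count_le_editDist_add_count`). [cite: BringmannKunnemannFOCS2015, Lemma 5.8 (proof)] -/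
theorem le_editDist_replicate_add_count (u : List α) (σ : α) (N : ℕ) :
    N ≤ editDist u (List.replicate N σ) + u.count σ := by
  simpa using count_le_editDist_add_count u (List.replicate N σ) σ

/-- The traversal "substitute the non-`σ` symbols of `u`, match its `σ`'s, delete the surplus of the
block": `editDist u σ^N + #σ(u) ≤ N` for `|u| ≤ N`. [cite: BringmannKunnemannFOCS2015, Lemma 5.8 (proof)] -/
theorem editDist_replicate_add_count_le (u : List α) (σ : α) (N : ℕ) (hu : u.length ≤ N) :
    editDist u (List.replicate N σ) + u.count σ ≤ N := by
  induction u generalizing N with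
  | nil => simp
  | cons a u ih =>
      cases N with
      | zero => simp at hu
      | succ N =>
          have hu' : u.length ≤ N := by simpa using hu
          have h := ih N hu'
          rw [List.replicate_succ, editDist_cons_cons, List.count_cons]
          have h3 : min (editDist u (σ :: List.replicate N σ) + 1)
              (min (editDist (a :: u) (List.replicate N σ) + 1)
                (editDist u (List.replicate N σ) + if a = σ then 0 else 1)) ≤
              editDist u (List.replicate N σ) + (if a = σ then 0 else 1) :=
            (min_le_right _ _).trans (min_le_right _ _)
          simp only [beq_iff_eq]
          split_ifs at * <;> omega

/-- **Edit distance to a block of one symbol** (BK15, proof of Lemma 5.8): for `|u| ≤ N`,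
`editDist u σ^N + #σ(u) = N`, i.e. `editDist u σ^N = (number of non-σ symbols of u) + (N - |u|)`.
[cite: BringmannKunnemannFOCS2015, Lemma 5.8 (proof)] -/
theorem editDist_replicate_add_count (u : List α) (σ : α) (N : ℕ) (hu : u.length ≤ N) :
    editDist u (List.replicate N σ) + u.count σ = N :=
  le_antisymm (editDist_replicate_add_count_le u σ N hu) (le_editDist_replicate_add_count u σ N)

/-! ### Substrings -/

/-- Removing a prefix `x₁` of the first list changes the distance by at most `|x₁|`, lower half:
`editDist x₂ y ≤ editDist (x₁ ++ x₂) y + |x₁|` (BK15, Fact 5.5(3), prefix form).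
[cite: BringmannKunnemannFOCS2015, Fact 5.5(3)] -/
theorem editDist_le_editDist_append_left_add_length (x₁ x₂ y : List α) :
    editDist x₂ y ≤ editDist (x₁ ++ x₂) y + x₁.length := by
  induction x₁ with
  | nil => simp
  | cons a x₁ ih =>
      have := editDist_le_cons_left a (x₁ ++ x₂) y
      simp only [List.cons_append, List.length_cons]
      omega

/-- Moving the right end of a substring: `editDist x[a..d) y ≤ editDist x[a..b) y + |b - d|`.
[cite: BringmannKunnemannFOCS2015, Fact 5.5(3)] -/
theorem editDist_drop_take_le_right (x y : List α) (a b d : ℕ) :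
    editDist ((x.take d).drop a) y ≤ editDist ((x.take b).drop a) y + ((b - d) + (d - b)) := by
  rcases le_total b d with hbd | hdb
  · -- `x.take d = x.take b ++ X` with `|X| ≤ d - b`
    have hT : x.take d = x.take b ++ (x.take d).drop b := by
      conv_lhs => rw [← List.take_append_drop b (x.take d)]
      rw [List.take_take, min_eq_left hbd]
    have hX : ((x.take d).drop b).length ≤ d - b := by
      simp only [List.length_drop, List.length_take]; omega
    rw [hT, List.drop_append]
    have := editDist_append_le_add_length ((x.take b).drop a)
      (List.drop (a - (x.take b).length) ((x.take d).drop b)) y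
    have hX' : (List.drop (a - (x.take b).length) ((x.take d).drop b)).length ≤ d - b := by
      simp only [List.length_drop] at hX ⊢; omega
    omega
  · have hT : x.take b = x.take d ++ (x.take b).drop d := by
      conv_lhs => rw [← List.take_append_drop d (x.take b)]
      rw [List.take_take, min_eq_left hdb]
    have hX : ((x.take b).drop d).length ≤ b - d := by
      simp only [List.length_drop, List.length_take]; omega
    rw [hT, List.drop_append]
    have := editDist_le_editDist_append_add_length ((x.take d).drop a)
      (List.drop (a - (x.take d).length) ((x.take b).drop d)) y
    have hX' : (List.drop (a - (x.take d).length) ((x.take b).drop d)).length ≤ b - d := by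
      simp only [List.length_drop] at hX ⊢; omega
    omega

/-- Moving the left end of a substring: `editDist x[c..d) y ≤ editDist x[a..d) y + |a - c|`.
[cite: BringmannKunnemannFOCS2015, Fact 5.5(3)] -/
theorem editDist_drop_take_le_left (x y : List α) (a c d : ℕ) :
    editDist ((x.take d).drop c) y ≤ editDist ((x.take d).drop a) y + ((a - c) + (c - a)) := by
  rcases le_total a c with hac | hca
  · have hT : (x.take d).drop a = ((x.take d).drop a).take (c - a) ++ (x.take d).drop c := by
      conv_lhs => rw [← List.take_append_drop (c - a) ((x.take d).drop a)]
      rw [List.drop_drop, Nat.add_sub_cancel' hac]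
    have hX : (((x.take d).drop a).take (c - a)).length ≤ c - a := by
      simp only [List.length_take]; omega
    have := editDist_le_editDist_append_left_add_length (((x.take d).drop a).take (c - a))
      ((x.take d).drop c) y
    rw [← hT] at this
    omega
  · have hT : (x.take d).drop c = ((x.take d).drop c).take (a - c) ++ (x.take d).drop a := by
      conv_lhs => rw [← List.take_append_drop (a - c) ((x.take d).drop c)]
      rw [List.drop_drop, Nat.add_sub_cancel' hca]
    have hX : (((x.take d).drop c).take (a - c)).length ≤ a - c := by
      simp only [List.length_take]; omega
    have := editDist_append_left_le (((x.take d).drop c).take (a - c)) ((x.take d).drop a) y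
    rw [← hT] at this
    omega

/-- **Perturbing a substring at both ends** (BK15, Fact 5.5(3) applied twice): for substrings
`x[a..b)` and `x[c..d)` of one string, `editDist x[c..d) y ≤ editDist x[a..b) y + |a-c| + |b-d|`.
[cite: BringmannKunnemannFOCS2015, Fact 5.5(3)] -/
theorem editDist_drop_take_le (x y : List α) (a b c d : ℕ) :
    editDist ((x.take d).drop c) y ≤
      editDist ((x.take b).drop a) y + ((a - c) + (c - a)) + ((b - d) + (d - b)) := by
  have h1 := editDist_drop_take_le_left x y a c d
  have h2 := editDist_drop_take_le_right x y a b d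
  omega

/-! ### Bookkeeping for substrings `x[a..b) = (x.take b).drop a` -/

omit [DecidableEq α] in
/-- `|x[a..b)| = min b |x| - a`. [folklore] -/
theorem length_drop_take' (x : List α) (a b : ℕ) :
    ((x.take b).drop a).length = min b x.length - a := by
  simp

/-- Symbol counts are additive along a cut: `#σ(x[0..a)) + #σ(x[a..b)) = #σ(x[0..b))` for `a ≤ b`.
[folklore] -/
theorem count_take_add_count_drop_take (x : List α) (σ : α) {a b : ℕ} (hab : a ≤ b) :
    (x.take a).count σ + ((x.take b).drop a).count σ = (x.take b).count σ := by
  conv_rhs => rw [← List.take_append_drop a (x.take b)]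
  rw [List.count_append, List.take_take, min_eq_left hab]

/-- The prefix counts `a ↦ #σ(x[0..a))` are monotone. [folklore] -/
theorem count_take_mono (x : List α) (σ : α) {a b : ℕ} (hab : a ≤ b) :
    (x.take a).count σ ≤ (x.take b).count σ := by
  have := count_take_add_count_drop_take x σ hab
  omega

/-- The prefix counts grow at most like the length: `#σ(x[0..b)) ≤ #σ(x[0..a)) + (b - a)` for
`a ≤ b`. [folklore] -/
theorem count_take_le_count_take_add (x : List α) (σ : α) {a b : ℕ} (hab : a ≤ b) :
    (x.take b).count σ ≤ (x.take a).count σ + (b - a) := by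
  have h1 := count_take_add_count_drop_take x σ hab
  have h2 : ((x.take b).drop a).count σ ≤ ((x.take b).drop a).length := List.count_le_length
  have h3 := length_drop_take' x a b
  omega

omit [DecidableEq α] in
/-- A substring of the middle part of a concatenation, addressed from the start of the whole:
`(A ++ M ++ B)[|A|+u..|A|+v) = M[u..v)` for `v ≤ |M|`. [folklore] -/
theorem drop_take_append_middle (A M B : List α) {u v : ℕ} (hv : v ≤ M.length) :
    ((A ++ M ++ B).take (A.length + v)).drop (A.length + u) = (M.take v).drop u := by
  rw [List.append_assoc, List.take_length_add_append, List.drop_length_add_append,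
    List.take_append_of_le_length hv]

/-! ### Splitting with positions (BK15, Fact 5.7) -/

/-- **Splitting an optimal traversal along blocks, with positions** (Bringmann–Künnemann, FOCS
2015, Fact 5.7): if the second string is a concatenation of blocks `B₀ ⋯ B_{k-1}` (`k ≥ 1`), there
are cut points `0 = t₀ ≤ t₁ ≤ ⋯ ≤ t_k = |x|` (extended constantly by `|x|` beyond `k`) with
`∑_{i<k} editDist x[tᵢ..tᵢ₊₁) Bᵢ ≤ editDist x (B₀ ⋯ B_{k-1})`. [cite: BringmannKunnemannFOCS2015, Fact 5.7] -/
theorem exists_boundaries_editDist_le (Bs : List (List α)) (hBs : Bs ≠ []) (x : List α) :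
    ∃ t : ℕ → ℕ, t 0 = 0 ∧ (∀ i, Bs.length ≤ i → t i = x.length) ∧ Monotone t ∧
      (∀ i, t i ≤ x.length) ∧
      ∑ i ∈ range Bs.length, editDist ((x.take (t (i + 1))).drop (t i)) (Bs.getD i []) ≤
        editDist x Bs.flatten := by
  induction Bs generalizing x with
  | nil => exact absurd rfl hBs
  | cons B Bs ih =>
      rcases Bs with _ | ⟨B', Bs'⟩
      · -- one block: no cut
        refine ⟨fun i => if i = 0 then 0 else x.length, by simp, ?_, ?_, ?_, ?_⟩
        · intro i hi
          have : i ≠ 0 := by simp at hi; omega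
          simp [this]
        · intro i j hij
          by_cases hi : i = 0
          · simp [hi]
          · have hj : j ≠ 0 := by omega
            simp [hi, hj]
        · intro i; dsimp only; split_ifs <;> omega
        · simp
      · -- cut `x = x₁ ++ x₂` where `B` ends, then recurse on `x₂`
        obtain ⟨x₁, x₂, hx, hle⟩ := exists_split_editDist_le x B (B' :: Bs').flatten
        obtain ⟨t', ht0, htk, hmono, hle', hsum⟩ := ih (List.cons_ne_nil _ _) x₂
        refine ⟨fun i => if i = 0 then 0 else x₁.length + t' (i - 1), by simp, ?_, ?_, ?_, ?_⟩
        · intro i hi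
          have hi0 : i ≠ 0 := by simp at hi; omega
          have : (B' :: Bs').length ≤ i - 1 := by simp at hi ⊢; omega
          simp only [hi0, if_false, htk _ this, ← hx, List.length_append]
        · intro i j hij
          by_cases hi : i = 0
          · simp [hi]
          · have hj : j ≠ 0 := by omega
            simp only [hi, hj, if_false]
            exact Nat.add_le_add_left (hmono (by omega)) _
        · intro i
          dsimp only
          split_ifs
          · omega
          · have := hle' (i - 1); rw [← hx, List.length_append]; omega
        · rw [List.length_cons, sum_range_succ', List.flatten_cons]
          simp only [Nat.succ_ne_zero, if_false, Nat.add_sub_cancel, if_true, List.drop_zero,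
            List.getD_cons_zero, List.getD_cons_succ, List.length_cons]
          have hx1 : x.take (x₁.length + t' 0) = x₁ := by
            rw [ht0, Nat.add_zero, ← hx, List.take_left' rfl]
          rw [hx1]
          have hpieces : ∀ i, (x.take (x₁.length + t' (i + 1))).drop (x₁.length + t' i) =
              (x₂.take (t' (i + 1))).drop (t' i) := by
            intro i
            rw [← hx, List.take_length_add_append, List.drop_length_add_append]
          simp only [hpieces]
          simp only [List.length_cons] at hsum
          omega

end Literature.Computability.Cryptography
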